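import Mathlib
import HarnessLib
import Literature.Analysis.SpecialFunctions.EulerMascheroniBounds

/-!
# The constant inequality: stub `stub_numerics` of the line `Sketch` (crux stmt-RiemannHypothesis-16305)

The far-field sign-cone bound `Re W_ar(F) ≥ -Re F(0)` is reduced by the lead skeleton
(`SignCone.SignConeFarField`, plastic-weight bookkeeping) to the pure constant inequality
`97/28·t₁ + 2.79·(t₂ − t₁) + 4/25 + (log 3 − 1/1000) ≥ log 4π + γ − 1` with
`t₁ = 4 log(15/14)`, `t₂ = 2 log(7/6)` (numerically `2.3039 ≥ 2.1082`, margin `0.196`).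

Sufficient inputs (all elementary): `log(4π) = 2 log 2 + log 3 + log(π/3) ≤ 2 log 2 + log 3 + (π/3 − 1)
≤ 2.5322` (Mathlib decimals `log_two_lt_d9`, `log_three_lt_d9`, `pi_lt_d4`), `γ < 0.57721571`
(`Literature.Analysis.SpecialFunctions.Real.eulerMascheroniConstant_lt_d8`), and the lower bounds
`log(15/14) ≥ 2/29`, `log(7/6) ≥ 2/13` (`log(1 + 1/a) ≥ 2/(2a+1)`,
`Literature.Analysis.SpecialFunctions.Real.two_div_le_log_one_add_inv`), `log 3 > 1.0986122885`;
then `linarith` (certified margin `≈ 0.19`).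
-/

noncomputable section

-- `Summit.RiemannHypothesis.RiemannHypothesis.…` repeats a namespace component by design (D-0017 layout).
set_option linter.dupNamespace false

namespace Summit.RiemannHypothesis.RiemannHypothesis.Theorems.SignConeFarField

/-- `log(4π) = 2 log 2 + log 3 + log(π/3)`. [folklore] -/
private lemma log_four_pi_eq :
    Real.log (4 * Real.pi) = 2 * Real.log 2 + Real.log 3 + Real.log (Real.pi / 3) := by
  have h : (4 : ℝ) * Real.pi = 2 ^ 2 * 3 * (Real.pi / 3) := by ring
  rw [h, Real.log_mul (by positivity) (by positivity), Real.log_mul (by positivity) (by positivity),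
    Real.log_pow]
  push_cast
  ring

/-- `log(4π) ≤ 2.5322` (true value `2.53102…`), from `log(π/3) ≤ π/3 − 1` and `π < 3.1416`. [folklore] -/
private lemma log_four_pi_le : Real.log (4 * Real.pi) ≤ 2.5322 := by
  rw [log_four_pi_eq]
  have h2 := Real.log_two_lt_d9
  have h3 := Real.log_three_lt_d9
  have hπ := Real.pi_lt_d4
  have hπ3 : Real.log (Real.pi / 3) ≤ Real.pi / 3 - 1 := Real.log_le_sub_one_of_pos (by positivity)
  linarith

/-- `2/29 ≤ log(15/14)` (`log(1 + 1/a) ≥ 2/(2a+1)` at `a = 14`). [folklore] -/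
private lemma log_fifteen_fourteenths_ge : 2 / 29 ≤ Real.log (15 / 14) := by
  have h := Literature.Analysis.SpecialFunctions.Real.two_div_le_log_one_add_inv (a := 14) (by norm_num)
  norm_num at h
  exact h

/-- `2/13 ≤ log(7/6)` (`log(1 + 1/a) ≥ 2/(2a+1)` at `a = 6`). [folklore] -/
private lemma log_seven_sixths_ge : 2 / 13 ≤ Real.log (7 / 6) := by
  have h := Literature.Analysis.SpecialFunctions.Real.two_div_le_log_one_add_inv (a := 6) (by norm_num)
  norm_num at h
  exact h

/-- **Stub (the constant).** `97/28·t₁ + 2.79·(t₂ − t₁) + 4/25 + log 3 − 1/1000 ≥ log 4π + γ − 1`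
(`= 2.3039 ≥ 2.1082`); certified with `log(15/14) ≥ 2/29`, `log(7/6) ≥ 2/13`, `log 3 > 1.0986122885`,
`log(4π) ≤ 2.5322`, `γ < 0.57721571` (margin `≈ 0.19`). -/
theorem stub_numerics :
    Real.log (4 * Real.pi) + Real.eulerMascheroniConstant - 1 ≤
      97 / 28 * (4 * Real.log (15 / 14)) + 279 / 100 * (2 * Real.log (7 / 6) - 4 * Real.log (15 / 14)) +
        4 / 25 + (Real.log 3 - 1 / 1000) := by
  have h4π := log_four_pi_le
  have hγ := Literature.Analysis.SpecialFunctions.Real.eulerMascheroniConstant_lt_d8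
  have hL1 := log_fifteen_fourteenths_ge
  have hL2 := log_seven_sixths_ge
  have h3 := Real.log_three_gt_d9
  linarith

end Summit.RiemannHypothesis.RiemannHypothesis.Theorems.SignConeFarField

end
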